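import Literature.AlgebraicGeometry.HodgeTheory.ZariskiClosureFiniteIndex
import HarnessLib

/-!
# Closure membership pulls back along maps `GL(V) → GL(V')` with entries in `K[x_{ij}, 1/det]`
# (Borel, *Linear Algebraic Groups*, I.1.7, I.2.1 (b): a morphism of affine groups carries `Ā` into the
# closure of the image of `A`), on `K`-points, between DIFFERENT spaces

Family `hodge`, layer `Literature/AlgebraicGeometry/HodgeTheory`. THEOREMS extending
`GlZariskiClosureGroup` (§1 there: `evalAtInvDet`, relations `Q(x, 1/det x) = 0` persist on the entry-closure)
and `ZariskiClosureFiniteIndex` (`mem_zariskiClosureEndOfBasis_of_polynomialMap`: polynomial self-maps of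
`End V`) to maps into a SECOND space `V'` whose matrix in a basis `b'` is a matrix of elements of
`K[x_{ij}][y]` evaluated at `([f]_b, 1/det [f]_b)`: closure membership pulls back
(`mem_zariskiClosureEndOfBasis_of_rationalMap`), hence `Γ^Zar(K) → (Γ')^Zar(K)` whenever `Φ(Γ) ⊆ Γ'`
(`mem_glZariskiClosure_of_rationalMap`), and `(Γ^Zar)°(K) → ((Γ')^Zar)°(K)` whenever every finite-index
`Λ' ≤ Γ'` receives some finite-index `Λ ≤ Γ` (`mem_glIdentityComponent_of_rationalMap`; in particular when
`Φ|_Γ` is a homomorphism onto `Γ'`, `mem_glIdentityComponent_range_of_rationalMap`). Written by the prover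
seat `hodge-nonav-prover-A` (cell `hodge-nonav`) for the crux K1 `VeryGeneralDeckCommutatorsInHg`
(`stmt-HodgeConjecture-19544`), lane-D glue `stub_unitaryCommutatorsInMon_of_facts`, step (g) of memo
LANE-D-ROADMAP-Ax-g0 §2 ("polynomial section": the `τ`-commuting `B`-isometries are determined by HALF their
eigenblocks through `u_{p−j} = (u_j^†)⁻¹`, a map with entries in `ℂ[x, 1/det]` from `GL(⊕_{j∈J} E_j)` to
`GL(V_ℂ)`; the identity-component membership delivered by the Goursat–Kolchin–Ribet criterion on the
`J`-blocks must be transported along it) and for the transport between the block picture `GL(Π_j E_j)` of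
`Katz1990_goursatKolchinRibet_specialLinear'` and `GL(V_ℂ)`.

## What is proved (any field `K`; `V`, `V'` finite-dimensional with bases `b`, `b'`)
* `mem_zariskiClosureEndOfBasis_of_rationalMap` — if every `s ∈ S` has a partner `t ∈ T` with
  `[t]_{b'} = F([s]_b, 1/det [s]_b)` (`F` a matrix over `K[x_{ij}][y]`, all `[s]_b` and `[f]_b` invertible), and
  `[f']_{b'} = F([f]_b, 1/det [f]_b)`, then `f ∈ cl_b(S) ⇒ f' ∈ cl_{b'}(T)`.
* `mem_zariskiClosureEndOfBasis_of_polynomialMap₂` — the same for polynomial `F` (no invertibility needed).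
* `mem_glZariskiClosure_of_rationalMap` — `g ∈ Γ^Zar(K)`, `Φ(Γ) ⊆ Γ'` ⇒ `Φ g ∈ (Γ')^Zar(K)`, for
  `Φ : GL(V) → GL(V')` with a `K[x, 1/det]` matrix formula.
* `mem_glIdentityComponent_of_rationalMap` — `g ∈ (Γ^Zar)°(K)` ⇒ `Φ g ∈ ((Γ')^Zar)°(K)` when every
  finite-index `Λ' ≤ Γ'` contains the image of a finite-index `Λ ≤ Γ`;
  `mem_glIdentityComponent_range_of_rationalMap` — the case `Φ|_Γ = φ` a homomorphism, `Γ' = φ(Γ)`.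

## References
* [Borel1991] A. Borel, *Linear Algebraic Groups*, 2nd ed., GTM 126 (1991): I.1.7 (`K[GL_n] = K[x, 1/det]`),
  I.2.1 (b) (`α(Ā) ⊆ closure of α(A)` for morphisms), I.1.2 (identity components).
* [CarlsonMullerStachPeters2017] J. Carlson, S. Müller-Stach, C. Peters, *Period Mappings and Period
  Domains*, 2nd ed. (2017), Lemma–Definition 15.3.7 (the vocabulary `Γ^Zar`, `Mon = (Γ^Zar)°`).
-/

noncomputable section

open Literature.AlgebraicGeometry.Motives

namespace Literature.AlgebraicGeometry.HodgeTheory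

universe u v w

variable {K : Type u} [Field K] {V : Type v} [AddCommGroup V] [Module K V]
  {V' : Type w} [AddCommGroup V'] [Module K V']
variable {ι : Type*} [Fintype ι] [DecidableEq ι] {ι' : Type*} [Fintype ι'] [DecidableEq ι']

/-! ### §1 Entry-closures: pull-back along `K[x, 1/det]`-maps into a second space -/

/-- **Pull-back of closure membership along a `K[x, 1/det]`-map into another space** (Borel I.2.1 (b) with
I.1.7). If every `s ∈ S ⊆ End(V)` has a partner `t ∈ T ⊆ End(V')` with `[t]_{b'} = F([s]_b, 1/det [s]_b)` —
`F` a matrix over `K[x_{ij}][y]`, evaluated by `evalAtInvDet` — all `[s]_b` and `[f]_b` are invertible, and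
`[f']_{b'} = F([f]_b, 1/det [f]_b)`, then `f ∈ cl_b(S)` implies `f' ∈ cl_{b'}(T)`: a polynomial `P` vanishing
on `T` gives the relation `P(F(x, y)) = 0` on `S`, which persists at `f` (`evalAtInvDet_eq_zero_of_mem`).
[cite: Borel1991, I.2.1] -/
theorem mem_zariskiClosureEndOfBasis_of_rationalMap (b : Module.Basis ι K V) (b' : Module.Basis ι' K V')
    {S : Set (Module.End K V)} {T : Set (Module.End K V')}
    (F : Matrix ι' ι' (Polynomial (MvPolynomial (ι × ι) K)))
    (hS : ∀ s ∈ S, ∃ t ∈ T, LinearMap.toMatrix b' b' t = (evalAtInvDet (LinearMap.toMatrix b b s)).mapMatrix F)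
    (hSdet : ∀ s ∈ S, (LinearMap.toMatrix b b s).det ≠ 0)
    {f : Module.End K V} (hf : f ∈ zariskiClosureEndOfBasis b S) (hfdet : (LinearMap.toMatrix b b f).det ≠ 0)
    {f' : Module.End K V'} (hf' : LinearMap.toMatrix b' b' f' = (evalAtInvDet (LinearMap.toMatrix b b f)).mapMatrix F) :
    f' ∈ zariskiClosureEndOfBasis b' T := by
  intro P hP
  -- the relation `P(F(x, y))`, an element of `K[x][y]`, evaluated at `(M, 1/det M)`
  have hev : ∀ (M : Matrix ι ι K) (t : Module.End K V'),
      LinearMap.toMatrix b' b' t = (evalAtInvDet M).mapMatrix F →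
      evalAtInvDet M (MvPolynomial.aeval (fun ij : ι' × ι' => F ij.1 ij.2) P) =
        MvPolynomial.eval (fun ij : ι' × ι' => LinearMap.toMatrix b' b' t ij.1 ij.2) P := by
    intro M t ht
    rw [evalAtInvDet_aeval]
    refine congrArg (fun c => MvPolynomial.eval c P) (funext fun ij => ?_)
    rw [ht, RingHom.mapMatrix_apply, Matrix.map_apply]
  have h := evalAtInvDet_eq_zero_of_mem b hf hfdet hSdet (MvPolynomial.aeval (fun ij : ι' × ι' => F ij.1 ij.2) P)
    (fun s hs => by
      obtain ⟨t, ht, hts⟩ := hS s hs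
      rw [hev _ t hts]
      exact hP t ht)
  rwa [hev _ f' hf'] at h

/-- **Pull-back along a polynomial map into another space** (no invertibility needed): partners
`[t]_{b'} = F([s]_b)` with `F` a matrix of polynomials in the entries. [cite: Borel1991, I.2.1] -/
theorem mem_zariskiClosureEndOfBasis_of_polynomialMap₂ (b : Module.Basis ι K V) (b' : Module.Basis ι' K V')
    {S : Set (Module.End K V)} {T : Set (Module.End K V')} (F : Matrix ι' ι' (MvPolynomial (ι × ι) K))
    (hS : ∀ s ∈ S, ∃ t ∈ T, LinearMap.toMatrix b' b' t =
      (MvPolynomial.eval fun ij : ι × ι => LinearMap.toMatrix b b s ij.1 ij.2).mapMatrix F)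
    {f : Module.End K V} (hf : f ∈ zariskiClosureEndOfBasis b S) {f' : Module.End K V'}
    (hf' : LinearMap.toMatrix b' b' f' = (MvPolynomial.eval fun ij : ι × ι => LinearMap.toMatrix b b f ij.1 ij.2).mapMatrix F) :
    f' ∈ zariskiClosureEndOfBasis b' T := by
  intro P hP
  have hev : ∀ (g : Module.End K V) (t : Module.End K V'),
      LinearMap.toMatrix b' b' t = (MvPolynomial.eval fun ij : ι × ι => LinearMap.toMatrix b b g ij.1 ij.2).mapMatrix F →
      MvPolynomial.eval (fun ij : ι × ι => LinearMap.toMatrix b b g ij.1 ij.2)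
          (MvPolynomial.bind₁ (fun ij : ι' × ι' => F ij.1 ij.2) P) =
        MvPolynomial.eval (fun ij : ι' × ι' => LinearMap.toMatrix b' b' t ij.1 ij.2) P := by
    intro g t ht
    rw [MvPolynomial.eval, MvPolynomial.eval₂Hom_bind₁, ← MvPolynomial.eval, ← MvPolynomial.eval]
    refine congrArg (fun c => MvPolynomial.eval c P) (funext fun ij => ?_)
    rw [ht, RingHom.mapMatrix_apply, Matrix.map_apply]
  rw [← hev f f' hf']
  exact hf _ fun s hs => by
    obtain ⟨t, ht, hts⟩ := hS s hs
    rw [hev s t hts]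
    exact hP t ht

/-! ### §2 Closures and identity components of subgroups of `GL` -/

section GLMaps

variable [Module.Finite K V] [Module.Finite K V']

omit [Module.Finite K V] in
/-- The matrix of an automorphism has non-zero determinant. [folklore] -/
private theorem det_toMatrix_ne_zero' (b : Module.Basis ι K V) (g : V ≃ₗ[K] V) :
    (LinearMap.toMatrix b b (g : Module.End K V)).det ≠ 0 := by
  rw [LinearMap.det_toMatrix, ← LinearEquiv.coe_det]
  exact (LinearEquiv.det g).ne_zero

/-- **`Γ^Zar(K) → (Γ')^Zar(K)` along a `K[x, 1/det]`-map `Φ : GL(V) → GL(V')` with `Φ(Γ) ⊆ Γ'`** (Borel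
I.2.1 (b), on `K`-points; the matrix of `Φ g` in `b'` is `F([g]_b, 1/det [g]_b)`). [cite: Borel1991, I.2.1] -/
theorem mem_glZariskiClosure_of_rationalMap (b : Module.Basis ι K V) (b' : Module.Basis ι' K V')
    {Γ : Subgroup (V ≃ₗ[K] V)} {Γ' : Subgroup (V' ≃ₗ[K] V')}
    (F : Matrix ι' ι' (Polynomial (MvPolynomial (ι × ι) K))) (Φ : (V ≃ₗ[K] V) → (V' ≃ₗ[K] V'))
    (hΦ : ∀ g : V ≃ₗ[K] V, LinearMap.toMatrix b' b' (Φ g : Module.End K V') =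
      (evalAtInvDet (LinearMap.toMatrix b b (g : Module.End K V))).mapMatrix F)
    (hΓ : ∀ γ ∈ Γ, Φ γ ∈ Γ') {g : V ≃ₗ[K] V} (hg : g ∈ glZariskiClosure Γ) : Φ g ∈ glZariskiClosure Γ' := by
  classical
  rw [mem_glZariskiClosure_iff, ← zariskiClosureEnd_basis_indep b] at hg
  rw [mem_glZariskiClosure_iff, ← zariskiClosureEnd_basis_indep b']
  refine mem_zariskiClosureEndOfBasis_of_rationalMap b b' F ?_ ?_ hg (det_toMatrix_ne_zero' b g) (hΦ g)
  · rintro _ ⟨γ, hγ, rfl⟩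
    exact ⟨(Φ γ : Module.End K V'), ⟨Φ γ, hΓ γ hγ, rfl⟩, hΦ γ⟩
  · rintro _ ⟨γ, _, rfl⟩
    exact det_toMatrix_ne_zero' b γ

/-- The polynomial case of `mem_glZariskiClosure_of_rationalMap`: the matrix of `Φ g` is `F([g]_b)` with `F`
polynomial in the entries. [cite: Borel1991, I.2.1] -/
theorem mem_glZariskiClosure_of_polynomialMap₂ (b : Module.Basis ι K V) (b' : Module.Basis ι' K V')
    {Γ : Subgroup (V ≃ₗ[K] V)} {Γ' : Subgroup (V' ≃ₗ[K] V')}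
    (F : Matrix ι' ι' (MvPolynomial (ι × ι) K)) (Φ : (V ≃ₗ[K] V) → (V' ≃ₗ[K] V'))
    (hΦ : ∀ g : V ≃ₗ[K] V, LinearMap.toMatrix b' b' (Φ g : Module.End K V') =
      (MvPolynomial.eval fun ij : ι × ι => LinearMap.toMatrix b b (g : Module.End K V) ij.1 ij.2).mapMatrix F)
    (hΓ : ∀ γ ∈ Γ, Φ γ ∈ Γ') {g : V ≃ₗ[K] V} (hg : g ∈ glZariskiClosure Γ) : Φ g ∈ glZariskiClosure Γ' := by
  classical
  rw [mem_glZariskiClosure_iff, ← zariskiClosureEnd_basis_indep b] at hg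
  rw [mem_glZariskiClosure_iff, ← zariskiClosureEnd_basis_indep b']
  refine mem_zariskiClosureEndOfBasis_of_polynomialMap₂ b b' F ?_ hg (hΦ g)
  rintro _ ⟨γ, hγ, rfl⟩
  exact ⟨(Φ γ : Module.End K V'), ⟨Φ γ, hΓ γ hγ, rfl⟩, hΦ γ⟩

/-- **`(Γ^Zar)°(K) → ((Γ')^Zar)°(K)`** along a `K[x, 1/det]`-map `Φ : GL(V) → GL(V')` such that every
finite-index `Λ' ≤ Γ'` contains the image of some finite-index `Λ ≤ Γ` (Borel I.2.1 (b) with I.1.2: a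
morphism carries `G°` into `(G')°`). [cite: Borel1991, I.2.1 and I.1.2] -/
theorem mem_glIdentityComponent_of_rationalMap (b : Module.Basis ι K V) (b' : Module.Basis ι' K V')
    {Γ : Subgroup (V ≃ₗ[K] V)} {Γ' : Subgroup (V' ≃ₗ[K] V')}
    (F : Matrix ι' ι' (Polynomial (MvPolynomial (ι × ι) K))) (Φ : (V ≃ₗ[K] V) → (V' ≃ₗ[K] V'))
    (hΦ : ∀ g : V ≃ₗ[K] V, LinearMap.toMatrix b' b' (Φ g : Module.End K V') =
      (evalAtInvDet (LinearMap.toMatrix b b (g : Module.End K V))).mapMatrix F)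
    (hfi : ∀ Λ' : Subgroup (V' ≃ₗ[K] V'), Λ' ≤ Γ' → (Λ'.subgroupOf Γ').FiniteIndex →
      ∃ Λ : Subgroup (V ≃ₗ[K] V), Λ ≤ Γ ∧ (Λ.subgroupOf Γ).FiniteIndex ∧ ∀ γ ∈ Λ, Φ γ ∈ Λ')
    {g : V ≃ₗ[K] V} (hg : g ∈ glIdentityComponent Γ) : Φ g ∈ glIdentityComponent Γ' := by
  rw [mem_glIdentityComponent_iff] at hg ⊢
  intro Λ' hΛ' hfi'
  obtain ⟨Λ, hΛ, hfiΛ, hΛΛ'⟩ := hfi Λ' hΛ' hfi'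
  exact mem_glZariskiClosure_of_rationalMap b b' F Φ hΦ hΛΛ' (hg Λ hΛ hfiΛ)

/-- **`(Γ^Zar)°(K) → ((φ Γ)^Zar)°(K)`** for a map `Φ : GL(V) → GL(V')` with a `K[x, 1/det]` matrix formula
which restricts on `Γ` to a group homomorphism `φ : Γ →* GL(V')` (the preimage `Γ ∩ φ⁻¹Λ'` of a
finite-index `Λ' ≤ φ(Γ)` has finite index: `Subgroup.index_comap`). [cite: Borel1991, I.2.1 and I.1.2] -/
theorem mem_glIdentityComponent_range_of_rationalMap (b : Module.Basis ι K V) (b' : Module.Basis ι' K V')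
    {Γ : Subgroup (V ≃ₗ[K] V)} (φ : Γ →* (V' ≃ₗ[K] V'))
    (F : Matrix ι' ι' (Polynomial (MvPolynomial (ι × ι) K))) (Φ : (V ≃ₗ[K] V) → (V' ≃ₗ[K] V'))
    (hΦ : ∀ g : V ≃ₗ[K] V, LinearMap.toMatrix b' b' (Φ g : Module.End K V') =
      (evalAtInvDet (LinearMap.toMatrix b b (g : Module.End K V))).mapMatrix F)
    (hΦφ : ∀ γ : Γ, Φ γ = φ γ) {g : V ≃ₗ[K] V} (hg : g ∈ glIdentityComponent Γ) :
    Φ g ∈ glIdentityComponent φ.range := by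
  refine mem_glIdentityComponent_of_rationalMap b b' F Φ hΦ (fun Λ' _ hfi' => ?_) hg
  -- `Λ := Γ ∩ φ⁻¹ Λ'`, of finite index in `Γ`
  refine ⟨(Λ'.comap φ).map Γ.subtype, Subgroup.map_subtype_le _, ?_, ?_⟩
  · have h : ((Λ'.comap φ).map Γ.subtype).subgroupOf Γ = Λ'.comap φ := by
      change Subgroup.comap Γ.subtype _ = _
      exact Subgroup.comap_map_eq_self_of_injective Γ.subtype_injective _
    rw [h, Subgroup.finiteIndex_iff, Subgroup.index_comap]
    exact hfi'.index_ne_zero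
  · rintro _ ⟨γ, hγ, rfl⟩
    rw [Subgroup.subtype_apply, hΦφ]
    exact Subgroup.mem_comap.mp hγ

end GLMaps

end Literature.AlgebraicGeometry.HodgeTheory

end
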